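import Mathlib
import Literature.Analysis.FluidPDE.NSGalerkinTrajectory
import Literature.Analysis.FunctionSpaces.TorusSpaceTimeFields
import Literature.Analysis.FunctionSpaces.TorusCalculusProofs
import Literature.Analysis.FunctionSpaces.TorusLinearisedFormTruncation

/-!
# Route `WazewskiBlock`, crux `UniformWorkFloorTrap` (stmt-AnomalousDissipation-10353), line `Sketch`:
# the stress threshold empties the block (tightness of the core constants)

Along a global Galerkin trajectory `U` of order `N` (`Torus.IsGalerkinTrajectory ν f N U`) driven by a
Galerkin-mode force `f` of order `m ≤ N`, the work `W(t) = ∫⟪f, U t⟫` satisfies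
`W(t) − W(s) = ∫ₛᵗ r(τ) dτ` with the instantaneous work rate
`r(τ) = ∫⟪U τ, (U τ·∇) f⟫ + ν ∫⟪U τ, Δf⟫ + ∫‖f‖²` (the tested Galerkin identity with the admissible
test field `a := f`), and `r` is continuous in `τ` (joint continuity of the trajectory).

* `work_sub_work_eq_integral_workRate` — the work identity.
* `continuousOn_workRate` — continuity of the rate on `[0, ∞)`.
* `abs_work_le` — `|W| ≤ ‖f‖₂ (2 KE)^{1/2}` (Cauchy–Schwarz).
* `not_trapped_of_workRate_pos` — **work acceleration empties the block**: if `r ≥ δ > 0` on the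
  Galerkin modes of the energy ball `{kineticEnergy ≤ E}`, no Galerkin trajectory of order `N` stays in
  `{kineticEnergy ≤ E} ∩ {(f, ·) ≥ ε₀}` for all `t ≥ 0` (the work would grow linearly while bounded).
* `not_trapped_of_stressThreshold` — **the stress threshold**: if the Reynolds stress of every
  direction against the strain of the force is bounded below, `⟪w, Df(x) w⟫ ≥ −σ‖w‖²` (`σ ≥ 0`), and
  `2σE + ν (2E)^{1/2} ‖Δf‖₂ < ‖f‖₂²`, then the block holds no Galerkin trajectory of any order `N ≥ m`:
  witnesses of the crux need `E ≥ (‖f‖₂² − ν(2E)^{1/2}‖Δf‖₂) / (2σ*(f))` (card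
  `boundary-degree-readout`, `StressThresholdEmptiesBlock`; for Kolmogorov forcing `F sin(2πm x₁) e₂`:
  `σ* = πmF`, `E_c = F/(4πm)`).

These are NEGATIVE-side tightness facts for the line's core stub `stub_loudGalerkinFamily` (they bound
the admissible `(f, E)` of any supplier), landed as support of the crux item.
-/

noncomputable section

-- `Summit.<Summit>.<Problem>` is the tree's mandated summit-side namespace (CONVENTIONS §2); deliberate duplicate.
set_option linter.dupNamespace false

namespace Summit.AnomalousDissipation.AnomalousDissipation.Theorems.UniformWorkFloorTrap.Sketch

open scoped InnerProductSpace
open MeasureTheory Filter Set UnitAddTorus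
open Literature.Analysis.FunctionSpaces Literature.Analysis.FunctionSpaces.Torus
open Literature.Analysis.FluidPDE

variable {ν : ℝ} {m N : ℕ} {f : UnitAddTorus (Fin 3) → EuclideanSpace ℝ (Fin 3)}
  {U : ℝ → UnitAddTorus (Fin 3) → EuclideanSpace ℝ (Fin 3)}

/-- **The work identity.** Along a Galerkin trajectory of order `N ≥ m` with a Galerkin-mode force of
order `m`, `W(t) − W(s) = ∫ₛᵗ (∫⟪U,(U·∇)f⟫ + ν∫⟪U,Δf⟫ + ∫‖f‖²)` for `0 ≤ s ≤ t`: the tested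
Galerkin identity with `a := f`, the space integral split term by term (all fields smooth). [folklore] -/
theorem work_sub_work_eq_integral_workRate (hf : IsGalerkinMode m f) (hmN : m ≤ N)
    (hU : Torus.IsGalerkinTrajectory ν f N U) {s t : ℝ} (hs : 0 ≤ s) (hst : s ≤ t) :
    (∫ x, ⟪f x, U t x⟫_ℝ) - ∫ x, ⟪f x, U s x⟫_ℝ =
      ∫ τ in s..t, ((∫ x, ⟪U τ x, convect (U τ) f x⟫_ℝ) + ν * (∫ x, ⟪U τ x, laplacian f x⟫_ℝ) +
        ∫ x, ‖f x‖ ^ 2) := by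
  have hgal := hU.galerkin f (hf.mono hmN) s t hs hst
  have hcomm : ∀ τ : ℝ, (∫ x, ⟪f x, U τ x⟫_ℝ) = ∫ x, ⟪U τ x, f x⟫_ℝ := fun τ =>
    integral_congr_ae (ae_of_all _ fun x => real_inner_comm _ _)
  rw [hcomm t, hcomm s, hgal]
  refine intervalIntegral.integral_congr fun τ hτ => ?_
  rw [uIcc_of_le hst] at hτ
  have hτ0 : 0 ≤ τ := hs.trans hτ.1
  have hUτ : IsSmooth (U τ) := hU.isSmooth hτ0
  have iA : Integrable (fun x => ⟪U τ x, convect (U τ) f x⟫_ℝ) volume :=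
    (hUτ.inner (hUτ.convect hf.isSmooth)).integrable
  have iB : Integrable (fun x => ν * ⟪U τ x, laplacian f x⟫_ℝ) volume :=
    (hUτ.inner hf.isSmooth.laplacian).integrable.const_mul ν
  have iAB : Integrable
      (fun x => ⟪U τ x, convect (U τ) f x⟫_ℝ + ν * ⟪U τ x, laplacian f x⟫_ℝ) volume := iA.add iB
  have iC : Integrable (fun x => ⟪f x, f x⟫_ℝ) volume := (hf.isSmooth.inner hf.isSmooth).integrable
  rw [integral_add iAB iC, integral_add iA iB, integral_const_mul]
  simp_rw [real_inner_self_eq_norm_sq]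

/-- **The work rate is continuous in time** on `[0, ∞)` along a Galerkin trajectory (force smooth):
each space integrand has a space–time lift continuous on `[0, ∞) × ℝ³` (joint continuity of `U`,
`Df(x) w = ∑ᵢ wᵢ ∂ᵢ f(x)`), so `Torus.continuousOn_integral_of_continuousOn_stLift` applies. [folklore] -/
theorem continuousOn_workRate (hf : IsSmooth f) (hU : Torus.IsGalerkinTrajectory ν f N U) :
    ContinuousOn (fun τ => (∫ x, ⟪U τ x, convect (U τ) f x⟫_ℝ) +
      ν * (∫ x, ⟪U τ x, laplacian f x⟫_ℝ) + ∫ x, ‖f x‖ ^ 2) (Ici 0) := by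
  have hUc := hU.continuousOn
  -- the stress term
  have hA : ContinuousOn (fun τ => ∫ x, ⟪U τ x, convect (U τ) f x⟫_ℝ) (Ici 0) := by
    refine continuousOn_integral_of_continuousOn_stLift (u := fun τ x => ⟪U τ x, convect (U τ) f x⟫_ℝ) ?_
    have hD : ∀ i, Continuous fun q : ℝ × EuclideanSpace ℝ (Fin 3) => partialDeriv i f (proj q.2) :=
      fun i => ((hf.partialDeriv i).continuous.comp continuous_proj).comp continuous_snd
    have h : (stLift fun τ x => ⟪U τ x, convect (U τ) f x⟫_ℝ) =
        fun q => ⟪stLift U q, ∑ i, (stLift U q) i • partialDeriv i f (proj q.2)⟫_ℝ := by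
      funext q
      obtain ⟨τ, y⟩ := q
      simp only [stLift_apply, Torus.convect]
      rw [fderiv_apply_eq_sum_partialDeriv (hf.isContDiff (by simp))]
    rw [h]
    exact hUc.inner (continuousOn_finsetSum _ fun i _ =>
      ((EuclideanSpace.proj (𝕜 := ℝ) i).continuous.comp_continuousOn hUc).smul (hD i).continuousOn)
  -- the viscous term
  have hB : ContinuousOn (fun τ => ∫ x, ⟪U τ x, laplacian f x⟫_ℝ) (Ici 0) := by
    refine continuousOn_integral_of_continuousOn_stLift (u := fun τ x => ⟪U τ x, laplacian f x⟫_ℝ) ?_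
    have hL : Continuous fun q : ℝ × EuclideanSpace ℝ (Fin 3) => laplacian f (proj q.2) :=
      (hf.laplacian.continuous.comp continuous_proj).comp continuous_snd
    have h : (stLift fun τ x => ⟪U τ x, laplacian f x⟫_ℝ) =
        fun q => ⟪stLift U q, laplacian f (proj q.2)⟫_ℝ := by
      funext q
      obtain ⟨τ, y⟩ := q
      simp only [stLift_apply]
    rw [h]
    exact hUc.inner hL.continuousOn
  exact (hA.add (continuousOn_const.mul hB)).add continuousOn_const

/-- **Cauchy–Schwarz for the work**: `|∫⟪f, V⟫| ≤ ‖f‖₂ (2 KE(V))^{1/2}` for `L²` fields. [folklore] -/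
theorem abs_work_le {V : UnitAddTorus (Fin 3) → EuclideanSpace ℝ (Fin 3)} (hf : MemLp f 2 volume)
    (hV : MemLp V 2 volume) :
    |∫ x, ⟪f x, V x⟫_ℝ| ≤ Real.sqrt (∫ x, ‖f x‖ ^ 2) * Real.sqrt (2 * kineticEnergy V) := by
  have h := abs_integral_inner_le_sqrt_sq_mul_sqrt_sq hf hV
  have hKE : 2 * kineticEnergy V = ∫ x, ‖V x‖ ^ 2 := by
    simp only [kineticEnergy]; ring
  rwa [hKE]

/-- **Work acceleration empties the block.** If the instantaneous work rate is `≥ δ > 0` on every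
Galerkin mode of order `N` in the energy ball `{kineticEnergy ≤ E}`, then no global Galerkin
trajectory of order `N ≥ m` (Galerkin-mode force of order `m`) stays in
`{kineticEnergy ≤ E} ∩ {(f, ·) ≥ ε₀}` for all `t ≥ 0`: by the work identity and continuity of the rate,
`W(T) − W(0) ≥ δT`, while `|W| ≤ ‖f‖₂(2E)^{1/2}` in the block. (Card `boundary-degree-readout`,
`WorkAccelerationEmptiesBlock`.) [folklore] -/
theorem not_trapped_of_workRate_pos {E ε₀ δ : ℝ} (hf : IsGalerkinMode m f) (hmN : m ≤ N)
    (hU : Torus.IsGalerkinTrajectory ν f N U) (hδ : 0 < δ)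
    (hrate : ∀ V : UnitAddTorus (Fin 3) → EuclideanSpace ℝ (Fin 3), IsGalerkinMode N V →
      kineticEnergy V ≤ E →
      δ ≤ (∫ x, ⟪V x, convect V f x⟫_ℝ) + ν * (∫ x, ⟪V x, laplacian f x⟫_ℝ) + ∫ x, ‖f x‖ ^ 2) :
    ¬ (∀ t : ℝ, 0 ≤ t → kineticEnergy (U t) ≤ E ∧ ε₀ ≤ ∫ x, ⟪f x, U t x⟫_ℝ) := by
  intro htrap
  set B : ℝ := Real.sqrt (∫ x, ‖f x‖ ^ 2) * Real.sqrt (2 * E) with hB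
  have hB0 : 0 ≤ B := mul_nonneg (Real.sqrt_nonneg _) (Real.sqrt_nonneg _)
  have hfL2 : MemLp f 2 volume := hf.isSmooth.memLp 2
  -- the work is bounded by `B` in the block
  have hWabs : ∀ t : ℝ, 0 ≤ t → |∫ x, ⟪f x, U t x⟫_ℝ| ≤ B := by
    intro t ht
    refine (abs_work_le hfL2 ((hU.isSmooth ht).memLp 2)).trans ?_
    exact mul_le_mul_of_nonneg_left (Real.sqrt_le_sqrt (by linarith [(htrap t ht).1]))
      (Real.sqrt_nonneg _)
  -- linear growth of the work on `[0, T]`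
  set T : ℝ := (2 * B + 1) / δ with hT
  have hT0 : 0 ≤ T := div_nonneg (by linarith) hδ.le
  have hid := work_sub_work_eq_integral_workRate hf hmN hU le_rfl hT0 (ν := ν)
  have hcont := (continuousOn_workRate hf.isSmooth hU (ν := ν)).mono
    (show uIcc 0 T ⊆ Ici 0 by rw [uIcc_of_le hT0]; exact fun τ hτ => hτ.1)
  have hint : IntervalIntegrable (fun τ => (∫ x, ⟪U τ x, convect (U τ) f x⟫_ℝ) +
      ν * (∫ x, ⟪U τ x, laplacian f x⟫_ℝ) + ∫ x, ‖f x‖ ^ 2) volume 0 T :=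
    hcont.intervalIntegrable
  have hge : ∀ τ ∈ Icc 0 T, δ ≤ (∫ x, ⟪U τ x, convect (U τ) f x⟫_ℝ) +
      ν * (∫ x, ⟪U τ x, laplacian f x⟫_ℝ) + ∫ x, ‖f x‖ ^ 2 :=
    fun τ hτ => hrate (U τ) (hU.isGalerkinMode τ hτ.1) (htrap τ hτ.1).1
  have hgrowth : δ * T ≤ (∫ x, ⟪f x, U T x⟫_ℝ) - ∫ x, ⟪f x, U 0 x⟫_ℝ := by
    have h1 : ∫ _ in (0 : ℝ)..T, δ ≤ ∫ τ in (0 : ℝ)..T, ((∫ x, ⟪U τ x, convect (U τ) f x⟫_ℝ) +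
        ν * (∫ x, ⟪U τ x, laplacian f x⟫_ℝ) + ∫ x, ‖f x‖ ^ 2) :=
      intervalIntegral.integral_mono_on hT0 intervalIntegrable_const hint hge
    rw [intervalIntegral.integral_const, smul_eq_mul, sub_zero, mul_comm] at h1
    rwa [hid]
  have hWT := (abs_le.1 (hWabs T hT0)).2
  have hW0 := (abs_le.1 (hWabs 0 le_rfl)).1
  have hδT : δ * T = 2 * B + 1 := by rw [hT]; field_simp
  linarith

/-- **The stress threshold empties the block** (card `boundary-degree-readout`,
`StressThresholdEmptiesBlock`). Let `f` be a Galerkin-mode force of order `m ≤ N`, `ν ≥ 0`, `σ ≥ 0`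
a bound on the Reynolds stress of every direction against the strain of the force,
`⟪w, Df(x) w⟫ ≥ −σ‖w‖²` for all `x, w`, and suppose `2σE + ν (2E)^{1/2} ‖Δf‖₂ < ‖f‖₂²`. Then no
global Galerkin trajectory of order `N` stays in `{kineticEnergy ≤ E} ∩ {(f, ·) ≥ ε₀}` for all
`t ≥ 0`: on the energy ball the work rate is `≥ ‖f‖₂² − 2σE − ν(2E)^{1/2}‖Δf‖₂ > 0`
(`∫⟪V,(V·∇)f⟫ ≥ −σ∫‖V‖² = −2σ KE(V)`, Cauchy–Schwarz for the viscous term), and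
`not_trapped_of_workRate_pos` applies. Hence crux witnesses need
`E ≥ (‖f‖₂² − ν(2E)^{1/2}‖Δf‖₂)/(2σ*(f))`, `σ*(f) = maxₓ λ_max(−sym Df(x))`. [folklore] -/
theorem not_trapped_of_stressThreshold {E ε₀ σ : ℝ} (hf : IsGalerkinMode m f) (hmN : m ≤ N)
    (hν : 0 ≤ ν) (hσ : 0 ≤ σ) (hU : Torus.IsGalerkinTrajectory ν f N U)
    (hstrain : ∀ (x : UnitAddTorus (Fin 3)) (w : EuclideanSpace ℝ (Fin 3)),
      -(σ * ‖w‖ ^ 2) ≤ ⟪w, convect (fun _ => w) f x⟫_ℝ)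
    (hthr : 2 * σ * E + ν * Real.sqrt (2 * E) * Real.sqrt (∫ x, ‖laplacian f x‖ ^ 2) <
      ∫ x, ‖f x‖ ^ 2) :
    ¬ (∀ t : ℝ, 0 ≤ t → kineticEnergy (U t) ≤ E ∧ ε₀ ≤ ∫ x, ⟪f x, U t x⟫_ℝ) := by
  set δ : ℝ := (∫ x, ‖f x‖ ^ 2) - 2 * σ * E -
    ν * Real.sqrt (2 * E) * Real.sqrt (∫ x, ‖laplacian f x‖ ^ 2) with hδ
  refine not_trapped_of_workRate_pos (δ := δ) hf hmN hU (by rw [hδ]; linarith) fun V hV hKE => ?_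
  have hVs : IsSmooth V := hV.isSmooth
  -- stress term: `∫⟪V,(V·∇)f⟫ ≥ -σ ∫‖V‖² = -2σ KE(V) ≥ -2σE`
  have iA : Integrable (fun x => ⟪V x, convect V f x⟫_ℝ) volume :=
    (hVs.inner (hVs.convect hf.isSmooth)).integrable
  have iN : Integrable (fun x => -(σ * ‖V x‖ ^ 2)) volume :=
    (hVs.norm_sq.integrable.const_mul σ).neg
  have hA : -(2 * σ * E) ≤ ∫ x, ⟪V x, convect V f x⟫_ℝ := by
    have h1 : ∫ x, -(σ * ‖V x‖ ^ 2) ≤ ∫ x, ⟪V x, convect V f x⟫_ℝ :=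
      integral_mono iN iA fun x => hstrain x (V x)
    have h2 : ∫ x, -(σ * ‖V x‖ ^ 2) = -(σ * (2 * kineticEnergy V)) := by
      rw [integral_neg, integral_const_mul]
      simp only [kineticEnergy]
      ring
    rw [h2] at h1
    have h3 : σ * (2 * kineticEnergy V) ≤ σ * (2 * E) := by gcongr
    linarith
  -- viscous term: `ν∫⟪V,Δf⟫ ≥ -ν (2KE)^{1/2} ‖Δf‖₂ ≥ -ν (2E)^{1/2} ‖Δf‖₂`
  have hBabs : |∫ x, ⟪V x, laplacian f x⟫_ℝ| ≤
      Real.sqrt (2 * E) * Real.sqrt (∫ x, ‖laplacian f x‖ ^ 2) := by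
    have h := abs_integral_inner_le_sqrt_sq_mul_sqrt_sq (hVs.memLp 2) (hf.isSmooth.laplacian.memLp 2)
    refine h.trans (mul_le_mul_of_nonneg_right (Real.sqrt_le_sqrt ?_) (Real.sqrt_nonneg _))
    have : ∫ x, ‖V x‖ ^ 2 = 2 * kineticEnergy V := by simp only [kineticEnergy]; ring
    rw [this]; linarith
  have hB : -(ν * Real.sqrt (2 * E) * Real.sqrt (∫ x, ‖laplacian f x‖ ^ 2)) ≤
      ν * ∫ x, ⟪V x, laplacian f x⟫_ℝ := by
    have h1 := (abs_le.1 hBabs).1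
    have h2 := mul_le_mul_of_nonneg_left h1 hν
    linarith
  rw [hδ]
  linarith

end Summit.AnomalousDissipation.AnomalousDissipation.Theorems.UniformWorkFloorTrap.Sketch

end
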